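import Mathlib
import Summits.AtomisticToContinuum.Crystallization.Theorems.ThreeConeCertificateExactCertificateTransfer1DPositional

/-!
# Crux `ExactCertificate` (stmt-AtomisticToContinuum-11959), line `closure-makes-nogap-exact`,
# Transfer skeleton V (`OneCrossingChainCertificate`): stub `stub_groundStateUnique`

Support file for the crux `ThreeConeCertificate.ExactCertificate`, d = 1 transfer skeleton V
(`Cruxes.ExactCertificate.Transfer1D.OneCrossingChainCertificate`).  This file proves the registered
independent rigidity stub `stub_groundStateUnique` (Gardner–Radin form of d = 1 rigidity): for every `N`,
the ground state of `N` Lennard-Jones particles on a line is UNIQUE up to an isometry of the line, and it is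
centro-symmetric.

Mechanism (all ingredients are c7's d = 1 positional machinery):
* sort both ground states (`stub_lineSort.2`), so that both sorted coordinate lists minimise the line
  energy among configurations of `N` distinct reals (`pos1d_lineMin`);
* their nearest-neighbour gaps lie in the minimality box `[3/4, 1]` (`stub_lineMinGap`, `stub_lineMaxGap`);
* the midpoint configuration is increasing, hence admissible, so its line energy is `≥` the minimum, while
  uniform midpoint convexity in gap coordinates (`stub_lineEnergyConvex` fed with `stub_ljMidpointConvex`)
  puts it `≤` the minimum minus `¼ Σ (Δ gaps)²`; hence all gaps agree (`gsUnique_gaps_eq`) and the two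
  sorted lists differ by a translation (`gsUnique_translate`);
* the reflection `p ↦ −p` is an isometry of the line, so the reflected ground state is a ground state
  (`isGroundState_comp_isometry_iff`), and the first part applied to `x` and `−x` gives the centre.

All `[folklore]` (cf. Gardner–Radin 1979 for the structure of finite Lennard-Jones chain ground states).
-/

noncomputable section

namespace Summit.AtomisticToContinuum.Crystallization.Theorems.ThreeConeCertificateExactCertificate.Transfer1D

open Literature.MathematicalPhysics.StatisticalMechanics MeasureTheory Set Filter Topology
open scoped BigOperators

/-! ## Equal gaps of two sorted line-energy minimisers -/

/-- **Equal gaps.** Two strictly increasing configurations of `N` reals, each minimising the Lennard-Jones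
line energy among all configurations of `N` distinct reals, have the same nearest-neighbour gaps: both gap
vectors lie in the box `[3/4, 1]`, the midpoint configuration is an admissible competitor, and the line energy
is uniformly midpoint-strictly-convex in gap coordinates on the box, so `Σ_{i<N−1} (Δ gap_i)² ≤ 0`. [folklore] -/
theorem gsUnique_gaps_eq {N : ℕ} (y y' : ℕ → ℝ)
    (hy : ∀ i j : ℕ, i < j → j < N → y i < y j) (hy' : ∀ i j : ℕ, i < j → j < N → y' i < y' j)
    (hmin : ∀ z : ℕ → ℝ, (∀ i j : ℕ, i < j → j < N → z i ≠ z j) →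
      ∑ i ∈ Finset.range N, ∑ j ∈ Finset.Ico (i + 1) N, lennardJones (|y j - y i|) ≤
        ∑ i ∈ Finset.range N, ∑ j ∈ Finset.Ico (i + 1) N, lennardJones (|z j - z i|))
    (hmin' : ∀ z : ℕ → ℝ, (∀ i j : ℕ, i < j → j < N → z i ≠ z j) →
      ∑ i ∈ Finset.range N, ∑ j ∈ Finset.Ico (i + 1) N, lennardJones (|y' j - y' i|) ≤
        ∑ i ∈ Finset.range N, ∑ j ∈ Finset.Ico (i + 1) N, lennardJones (|z j - z i|)) :
    ∀ i : ℕ, i + 1 < N → y' (i + 1) - y' i = y (i + 1) - y i := by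
  -- the box `[3/4, 1]` for both gap vectors
  have hlo := stub_lineMinGap N y hy hmin
  have hhi := stub_lineMaxGap N y hy hmin
  have hlo' := stub_lineMinGap N y' hy' hmin'
  have hhi' := stub_lineMaxGap N y' hy' hmin'
  -- uniform midpoint convexity in gap coordinates
  have hD := stub_lineEnergyConvex lennardJones stub_ljMidpointConvex.1 stub_ljMidpointConvex.2 N y y'
    (fun i hi => ⟨hlo i hi, hhi i hi⟩) (fun i hi => ⟨hlo' i hi, hhi' i hi⟩)
  -- `L y' ≤ L y` (minimality of `y'` against `y`)
  have h2 := hmin' y (fun i j hij hjN => (hy i j hij hjN).ne)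
  -- the midpoint configuration is increasing, hence an admissible competitor: `L y ≤ L m`
  have hm : ∀ i j : ℕ, i < j → j < N → (y i + y' i) / 2 < (y j + y' j) / 2 :=
    fun i j hij hjN => by linarith [hy i j hij hjN, hy' i j hij hjN]
  have h3 := hmin (fun i => (y i + y' i) / 2) (fun i j hij hjN => (hm i j hij hjN).ne)
  rw [pos1d_sum_abs_eq _ _ _ hy] at h2 h3
  rw [pos1d_sum_abs_eq _ _ _ hy'] at h2
  rw [pos1d_sum_abs_eq lennardJones N (fun i => (y i + y' i) / 2) hm] at h3
  -- hence the (nonnegative) defect sum is `≤ 0`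
  have hS : ∑ i ∈ Finset.range (N - 1), ((y' (i + 1) - y' i) - (y (i + 1) - y i)) ^ 2 ≤ 0 := by
    linarith
  have hS0 : ∀ i ∈ Finset.range (N - 1), ((y' (i + 1) - y' i) - (y (i + 1) - y i)) ^ 2 = 0 :=
    (Finset.sum_eq_zero_iff_of_nonneg fun i _ => sq_nonneg _).1
      (le_antisymm hS (Finset.sum_nonneg fun i _ => sq_nonneg _))
  intro i hi
  have h0 : (y' (i + 1) - y' i) - (y (i + 1) - y i) = 0 :=
    (pow_eq_zero_iff two_ne_zero).1 (hS0 i (Finset.mem_range.2 (by omega)))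
  linarith

/-! ## Uniqueness up to translation -/

/-- **Uniqueness of the Lennard-Jones chain ground state up to relabelling and translation.** Any two ground
states `x, x'` of `N` Lennard-Jones particles on a line satisfy `x' (σ i) = x i + s e₀` for a relabelling `σ`
and a shift `s`: sort both (`stub_lineSort.2`), the sorted lists are line-energy minimisers (`pos1d_lineMin`)
with equal gaps (`gsUnique_gaps_eq`), hence differ by the constant `s = y'_0 − y_0`. [folklore] -/
theorem gsUnique_translate (N : ℕ) (x x' : Fin N → EuclideanSpace ℝ (Fin 1))
    (hx : IsGroundState lennardJones x) (hx' : IsGroundState lennardJones x') :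
    ∃ (s : ℝ) (σ : Equiv.Perm (Fin N)), ∀ i : Fin N, x' (σ i) 0 = x i 0 + s := by
  -- sorting
  obtain ⟨σ, y, hy, hyx⟩ := stub_lineSort.2 N x hx.1
  obtain ⟨σ', y', hy', hyx'⟩ := stub_lineSort.2 N x' hx'.1
  have hmin := (pos1d_lineMin hx σ y hyx).2
  have hmin' := (pos1d_lineMin hx' σ' y' hyx').2
  -- equal gaps, hence a constant shift
  have hgap := gsUnique_gaps_eq y y' hy hy' hmin hmin'
  have hshift : ∀ i : ℕ, i < N → y' i = y i + (y' 0 - y 0) := by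
    intro i
    induction i with
    | zero => intro _; ring
    | succ k ih =>
      intro hk
      have h1 := hgap k hk
      have h2 := ih (by omega)
      linarith
  refine ⟨y' 0 - y 0, σ.symm.trans σ', fun j => ?_⟩
  have h1 : x' ((σ.symm.trans σ') j) = EuclideanSpace.single (0 : Fin 1) (y' (σ.symm j)) := by
    rw [Equiv.trans_apply]
    exact hyx' (σ.symm j)
  have h2 : x j = EuclideanSpace.single (0 : Fin 1) (y (σ.symm j)) := by
    rw [← hyx (σ.symm j), Equiv.apply_symm_apply]
  rw [h1, h2, PiLp.single_eq_same, PiLp.single_eq_same]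
  exact hshift (σ.symm j) (σ.symm j).2

/-! ## The stub -/

/-- **Registered stub `stub_groundStateUnique`** — FINITE LENNARD-JONES CHAIN GROUND STATES ARE UNIQUE UP TO
ISOMETRY AND CENTRO-SYMMETRIC (Gardner–Radin form of d = 1 rigidity): any two ground states of `N` Lennard-Jones
particles on a line differ by a relabelling and a translation (`gsUnique_translate`: sorted gaps in the
minimality box `[3/4, 1]`, strict midpoint convexity of the line energy ⇒ equal gap vectors), and every ground
state is symmetric about a centre (the reflection `p ↦ −p` is an isometry of the line, so `−x` is again a
ground state, and the first part applied to `x, −x` gives `x (τ i) = c − x i`). [folklore] -/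
theorem stub_groundStateUnique : ∀ (N : ℕ) (x x' : Fin N → EuclideanSpace ℝ (Fin 1)),
    IsGroundState lennardJones x → IsGroundState lennardJones x' →
    (∃ (s : ℝ) (σ : Equiv.Perm (Fin N)), ∀ i : Fin N, x' (σ i) 0 = x i 0 + s) ∧
    (∃ (c : ℝ) (τ : Equiv.Perm (Fin N)), ∀ i : Fin N, x (τ i) 0 = c - x i 0) := by
  intro N x x' hx hx'
  refine ⟨gsUnique_translate N x x' hx hx', ?_⟩
  -- the reflection of a ground state is a ground state
  have hiso : Isometry (fun p : EuclideanSpace ℝ (Fin 1) => -p) :=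
    Isometry.of_dist_eq fun p q => dist_neg_neg p q
  have hxneg : IsGroundState lennardJones (fun i => -x i) :=
    (isGroundState_comp_isometry_iff lennardJones hiso).2 hx
  obtain ⟨s, τ, hτ⟩ := gsUnique_translate N x (fun i => -x i) hx hxneg
  refine ⟨-s, τ, fun i => ?_⟩
  have h := hτ i
  simp only [PiLp.neg_apply] at h
  linarith

end Summit.AtomisticToContinuum.Crystallization.Theorems.ThreeConeCertificateExactCertificate.Transfer1D

end
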